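/-
Copyright (c) 2026 the pub-hodgecm-mathlib formalisation cell (harness21).  Prover seat hodgecm-mathlib-K2E4-p11 (g10) on the S4 valve (dealer K2E2-plan (g8), S4-R61,
[H-loc] MODEL cut, file (M-1)): THE TWISTED LINEAR PART AS A BICONTINUOUS ADDITIVE AUTOMORPHISM — `L_E : M_m(K) ≃ₜ+ M_m(K)`, `L_E = Ad(b⁻¹) + τ` on the moving space
`𝔪 = (Ad N − 1)M_m(K)`, `L_E = id` on the commutant `𝔷(N)`, at an ε-regular base point `b` with norm `N = b·τ(↑b⁻¹)` (no integrality of `b`).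
Crux H413 `stmt-HodgeConjecture-24833`, lane `--supports … --as helper` (count-neutral).  THEOREMS ONLY (no `def`, no `instance`, no notation, no named-fact hypothesis, no `sorry`).
-/
import Summits.HodgeConjecture.HodgeConjecture.Theorems.R90S4TwistedWeylJacobianAlgebra   -- ★ (TJ1) p864452: `tau_*`, `S_*`, `L_eq_tau_comp`, `S_sub_one_comp_S_add_one`, `tau_N(_inv)`, `N_mul_N_inv`, `b_mul_N`, `conj_adSubOne`, `tau_adSubOne`, `mem_range_adSubOne_iff`
import Summits.HodgeConjecture.HodgeConjecture.Theorems.F0P3cStCharTSJacCartanModelData      -- ★ (C8b-data): `exists_kerProjection`; brings ★ `exists_fixedSubfield`, `finiteDimensional_of_involutive`, `continuous_linearMap_matrix`, ★ `CartanDecompositionAd`, open mapping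
import HarnessLib

/-!
# R90-TF · S4 (Ch. 13.1–2) · road (J̃♭) «TWISTED TUBE JACOBIAN», [H-loc] MODEL file (M-1): THE TWISTED LINEAR PART `L_E` AS A BICONTINUOUS ADDITIVE AUTOMORPHISM OF `M_m(K)`
# (`L_E = Ad(b⁻¹) + τ` on `𝔪 = (Ad N − 1)M_m(K)`, `= id` on `𝔷(N)`; Rogawski 1990 §12.5 p. 186, Labesse 1999 §III.1, Harish-Chandra 1970 Lemma 22)

Dealt by the S4 dealer K2E2-plan (g8) (S4-R61, 2026-09-05T03:07:36Z, on the [H-loc] MODEL census of this seat).  Seat K2E4-p11 (g10).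
THE POINT.  The loss W-LOC ★ `R90S4TwistedTubeSocketLoss.twistedTubeJacobianLocal_of_chartData_loss'` (C131-p04) takes the linear part of the ε-twisted tube map as a
BINDER `(L : V ≃ₜ+ V) (hL : ι (L Z) = T⁻¹ ι(pM Z) T + E ι(pM Z) + ι(pT Z))`, and the twisted weight dock ★ (TJ3) `R90S4TwistedJacobianWeight.addEquivAddHaarChar_eq_sqrt_normAbs_twisted`
(R90-C131-p04) takes the SAME `L` with its two laws `(hLz : X N = N X → L X = X) (hLm : X = N Y N⁻¹ − Y → L X = b⁻¹ X b + τ X)`.  Nobody had BUILT this `L`.  This file builds it, at the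
matrix model `V = M_m(K)` (`ι = id`, `T = ↑b`, `E = τ = (X ↦ J⁻¹ (X.map σ)ᵀ J)`), for EVERY base point `b ∈ GL_m(K)` with `b ε(b) = ε(b) b` and `N = b ε(b)` regular semisimple — no
integrality, no compactness, no torus type — so that the [H-loc] MODEL head (M-3) `twistedTubeJacobianLocal_model` (R90-C131-p05) can feed ★ WL2′ and ★ (TJ3) BY NAME:
**`exists_twistedLinearEquiv`** returns the Cartan projections `pM, pT` (`pT` = ★ `exists_kerProjection`'s `K`-linear projection onto `𝔷(N) = ker(Ad N − 1)` along
`𝔪 = range(Ad N − 1)`, ★ `isCompl_ker_range_adSubOne`; `pM = id − pT`) and `L_E : V ≃ₜ+ V` with the fourteen letters the consumers read.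
CONSTRUCTION.  `L_E X := b⁻¹ (pM X) b + τ (pM X) + pT X` is `K^σ`-LINEAR (`τ (c • X) = σ c • τ X`, ★ `tau_smul`; `K^σ` = ★ `exists_fixedSubfield`).  INJECTIVE: if `L_E X = 0`, write
`m = pM X ∈ 𝔪`, `z = pT X ∈ 𝔷`; `b⁻¹ m b + τ m ∈ 𝔪` (★ (TJ1) `conj_adSubOne`, `tau_adSubOne`), so directness gives `z = 0` and `τ(S m + m) = b⁻¹ m b + τ m = 0` (★ `L_eq_tau_comp`),
hence `S m + m = 0` (★ `tau_tau`), hence `(Ad N⁻¹ − 1) m = S(S m + m) − (S m + m) = 0` (★ `S_sub_one_comp_S_add_one`), hence `m = 0` (★ `eq_zero_of_adInvSubOne_eq_zero`, `m ∈ 𝔪`).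
SURJECTIVE: `K ⊇ K^σ` is finite (★ `finiteDimensional_of_involutive`), so `M_m(K)` is finite over `K^σ` and `LinearMap.injective_iff_surjective` applies.  CONTINUOUS: the formula
(★ `continuous_linearMap_matrix`, `Continuous.matrix_map`, `.matrix_transpose`); the INVERSE is continuous by the OPEN MAPPING THEOREM `AddMonoidHom.isOpenMap_of_sigmaCompact`
(`M_m(K)` is σ-compact and Baire for a local field `K`) — the pattern of ★ `F0P3cStCharTSJacCartanModelData.exists_cartanData`.

HONEST LABEL: HC_CM is proved only modulo the 7 printed citations (2 remaining named inputs: hLiu418 = `stmt-HodgeConjecture-24832`, h413 = `stmt-HodgeConjecture-24833`)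
until rung 0 closes; this file closes no organ ((J̃♭) stays OPEN: it is row [H-M1] of the [H-loc] MODEL head); count-neutral helper.

## References
* [Rogawski1990] J. Rogawski, *Automorphic Representations of Unitary Groups in Three Variables*, Ann. of Math. Stud. 123 (1990), §12.5 p. 186; §3.11 p. 34.
* [Labesse1999] J.-P. Labesse, *Cohomologie, stabilisation et changement de base*, Astérisque 257 (1999), §III.1.
* [HarishChandra1970] Harish-Chandra (notes by G. van Dijk), *Harmonic Analysis on Reductive p-adic Groups*, LNM 162 (1970), Lemma 22.
* [PlatonovRapinchuk1994] V. Platonov, A. Rapinchuk, *Algebraic Groups and Number Theory* (1994), §3.3.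
-/

set_option autoImplicit false
set_option linter.dupNamespace false

open Set Filter TopologicalSpace Topology Matrix
open Summit.HodgeConjecture.HodgeConjecture.Cruxes.H413
open Summit.HodgeConjecture.HodgeConjecture.Cruxes.H413.F0P3cStCharTSJacCartanWeight (map_smul_eq tau_add tau_sub tau_smul tau_tau)
open Summit.HodgeConjecture.HodgeConjecture.Cruxes.H413.F0P3cStCharTSCartanDecompositionAd
open Summit.HodgeConjecture.HodgeConjecture.Cruxes.H413.F0P3cStCharTSJacCartanModelData (exists_kerProjection)
open Summit.HodgeConjecture.HodgeConjecture.Cruxes.H413.F0P3cStCharTSJacCartanModelFrame (continuous_linearMap_matrix)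
open Summit.HodgeConjecture.HodgeConjecture.Cruxes.H413.F0P3cStCharTSJacCartanFixedField (exists_fixedSubfield finiteDimensional_of_involutive)
open scoped MatrixGroups

namespace Summit.HodgeConjecture.HodgeConjecture.R90.S4

variable {K : Type*} [Field K] [TopologicalSpace K] [IsTopologicalRing K] [T2Space K] [LocallyCompactSpace K] [SecondCountableTopology K] [PerfectField K]
  {m : ℕ}

/-- **THE TWISTED LINEAR PART `L_E` AS A BICONTINUOUS ADDITIVE AUTOMORPHISM OF `M_m(K)`.**  `σ` a continuous involution of the field `K` (`2 ≠ 0`), `J ∈ GL_m(K)` hermitian,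
`τ X = J⁻¹ (X.map σ)ᵀ J`; `b ∈ GL_m(K)` a base point commuting with `ε b = τ(↑b⁻¹)`, `N = b·τ(↑b⁻¹)` (the norm) with separable characteristic polynomial.  Then there are
additive `pM, pT : M_m(K) → M_m(K)` and `L : M_m(K) ≃ₜ+ M_m(K)` with: `pM + pT = id`, `pM` idempotent, both continuous and `K`-linear; `pT` lands in the commutant `𝔷(N)`,
`pM` kills `𝔷(N)` and lands in the moving space `𝔪 = {N Y N⁻¹ − Y}`; **`L Z = b⁻¹ (pM Z) b + τ (pM Z) + pT Z`** (the `hL` letter of ★ WL2′ at `ι = id`, `T = ↑b`, `E = τ`);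
`L X = X` on `𝔷(N)` and `L X = b⁻¹ X b + τ X` on `𝔪` (the two laws of ★ (TJ3)); and `L`, `L⁻¹` commute with the scalars of `K^σ` (the `hLss` letter of ★ `exists_depth` for a level
scalar `π ∈ K^σ`).  The inverse is continuous by the open mapping theorem; bijectivity by `K^σ`-finite-dimensionality and the injectivity computation
`(Ad N⁻¹ − 1) ∘ … ` of ★ (TJ1). [cite: Rogawski1990, §12.5 p. 186] [cite: Labesse1999, §III.1] [cite: HarishChandra1970, Lemma 22] [cite: PlatonovRapinchuk1994, §3.3] -/
theorem exists_twistedLinearEquiv (σ : K →+* K) (hσc : Continuous σ) (hσ2 : ∀ a, σ (σ a) = a) (h2 : (2 : K) ≠ 0)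
    (J : Matrix (Fin m) (Fin m) K) (hJ : IsUnit J.det) (hJh : (J.map σ)ᵀ = J)
    (b Nm : GL (Fin m) K)
    (hN : (Nm : Matrix (Fin m) (Fin m) K) = (b : Matrix (Fin m) (Fin m) K) * (J⁻¹ * (((b⁻¹ : GL (Fin m) K) : Matrix (Fin m) (Fin m) K).map σ)ᵀ * J))
    (hcomm : (b : Matrix (Fin m) (Fin m) K) * (J⁻¹ * (((b⁻¹ : GL (Fin m) K) : Matrix (Fin m) (Fin m) K).map σ)ᵀ * J) =
      (J⁻¹ * (((b⁻¹ : GL (Fin m) K) : Matrix (Fin m) (Fin m) K).map σ)ᵀ * J) * (b : Matrix (Fin m) (Fin m) K))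
    (hsep : (Nm : Matrix (Fin m) (Fin m) K).charpoly.Separable) :
    ∃ (pM pT : Matrix (Fin m) (Fin m) K →+ Matrix (Fin m) (Fin m) K) (L : Matrix (Fin m) (Fin m) K ≃ₜ+ Matrix (Fin m) (Fin m) K),
      (∀ Z, pM Z + pT Z = Z) ∧ (∀ Z, pM (pM Z) = pM Z) ∧ Continuous pM ∧ Continuous pT ∧
      (∀ Z, pT Z * (Nm : Matrix (Fin m) (Fin m) K) = (Nm : Matrix (Fin m) (Fin m) K) * pT Z) ∧
      (∀ X, X * (Nm : Matrix (Fin m) (Fin m) K) = (Nm : Matrix (Fin m) (Fin m) K) * X → pM X = 0) ∧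
      (∀ Z, ∃ Y : Matrix (Fin m) (Fin m) K, pM Z = (Nm : Matrix (Fin m) (Fin m) K) * Y * ((Nm⁻¹ : GL (Fin m) K) : Matrix (Fin m) (Fin m) K) - Y) ∧
      (∀ Z, L Z = ((b⁻¹ : GL (Fin m) K) : Matrix (Fin m) (Fin m) K) * pM Z * (b : Matrix (Fin m) (Fin m) K) + J⁻¹ * ((pM Z).map σ)ᵀ * J + pT Z) ∧
      (∀ X, X * (Nm : Matrix (Fin m) (Fin m) K) = (Nm : Matrix (Fin m) (Fin m) K) * X → L X = X) ∧
      (∀ X Y : Matrix (Fin m) (Fin m) K, X = (Nm : Matrix (Fin m) (Fin m) K) * Y * ((Nm⁻¹ : GL (Fin m) K) : Matrix (Fin m) (Fin m) K) - Y →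
        L X = ((b⁻¹ : GL (Fin m) K) : Matrix (Fin m) (Fin m) K) * X * (b : Matrix (Fin m) (Fin m) K) + J⁻¹ * (X.map σ)ᵀ * J) ∧
      (∀ (c : K) Z, pM (c • Z) = c • pM Z) ∧ (∀ (c : K) Z, pT (c • Z) = c • pT Z) ∧
      (∀ c : K, σ c = c → ∀ Z, L (c • Z) = c • L Z) ∧ (∀ c : K, σ c = c → ∀ Z, L.symm (c • Z) = c • L.symm Z) := by
  classical
  -- ### (0) names and algebraic facts about `N = b ε(b)` (★ (TJ3) §a verbatim)
  set B : Matrix (Fin m) (Fin m) K := (b : Matrix (Fin m) (Fin m) K) with hBdef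
  set Bi : Matrix (Fin m) (Fin m) K := ((b⁻¹ : GL (Fin m) K) : Matrix (Fin m) (Fin m) K) with hBidef
  set Nmat : Matrix (Fin m) (Fin m) K := (Nm : Matrix (Fin m) (Fin m) K) with hNmatdef
  set Ni : Matrix (Fin m) (Fin m) K := ((Nm⁻¹ : GL (Fin m) K) : Matrix (Fin m) (Fin m) K) with hNidef
  have hNinv : Ni = (J⁻¹ * (B.map σ)ᵀ * J) * Bi := by
    rw [hNidef, Matrix.coe_units_inv, ← hNmatdef, hN]
    exact Matrix.inv_eq_right_inv (N_mul_N_inv (σ := σ) (J := J) hJ b)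
  have hNu : IsUnit Nmat.det := (Matrix.isUnit_iff_isUnit_det _).1 (Units.isUnit Nm)
  have hτN' : J⁻¹ * (Nmat.map σ)ᵀ * J = Nmat⁻¹ := by
    rw [← Matrix.coe_units_inv, ← hNidef, hN, hNinv]; exact tau_N hJ hJh hσ2 b hcomm
  have hτNinv' : J⁻¹ * ((Nmat⁻¹).map σ)ᵀ * J = Nmat := by
    rw [← Matrix.coe_units_inv, ← hNidef, hNinv, hN]; exact tau_N_inv hJ hJh hσ2 b hcomm
  have hbN : B * Nmat = Nmat * B := by rw [hN]; exact b_mul_N b hcomm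
  have hNiNi : Ni = Nmat⁻¹ := by rw [hNidef, hNmatdef, Matrix.coe_units_inv]
  have hτ0 : J⁻¹ * ((0 : Matrix (Fin m) (Fin m) K).map σ)ᵀ * J = 0 := by
    rw [Matrix.map_zero σ (map_zero σ), Matrix.transpose_zero, Matrix.mul_zero, Matrix.zero_mul]
  -- ### (1) the decomposition `M = 𝔷(N) ⊕ 𝔪` and the `K`-linear projection onto `𝔷(N)` (★ C8b-data)
  have hcK := isCompl_ker_range_adSubOne Nm hsep
  obtain ⟨PK, hPKfix, hPK0⟩ := exists_kerProjection Nm hsep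
  -- every `Z` decomposes as `z + w`, `z ∈ 𝔷`, `w ∈ 𝔪`
  have hdec : ∀ Z : Matrix (Fin m) (Fin m) K, ∃ z w : Matrix (Fin m) (Fin m) K, z * Nmat = Nmat * z ∧ (∃ Y, w = Nmat * Y * Ni - Y) ∧ z + w = Z := by
    intro Z
    have hZ : Z ∈ (LinearMap.ker (LinearMap.mulLeftRight K ((Nm : Matrix (Fin m) (Fin m) K), ((Nm⁻¹ : GL (Fin m) K) : Matrix (Fin m) (Fin m) K)) - LinearMap.id :
        Matrix (Fin m) (Fin m) K →ₗ[K] Matrix (Fin m) (Fin m) K)) ⊔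
      (LinearMap.range (LinearMap.mulLeftRight K ((Nm : Matrix (Fin m) (Fin m) K), ((Nm⁻¹ : GL (Fin m) K) : Matrix (Fin m) (Fin m) K)) - LinearMap.id :
        Matrix (Fin m) (Fin m) K →ₗ[K] Matrix (Fin m) (Fin m) K)) := by
      rw [hcK.sup_eq_top]; exact Submodule.mem_top
    obtain ⟨z, hz, w, hw, hzw⟩ := Submodule.mem_sup.1 hZ
    exact ⟨z, w, (mem_ker_adSubOne_iff Nm z).1 hz, (mem_range_adSubOne_iff Nm w).1 hw, hzw⟩
  -- `PK` lands in `𝔷(N)`, `id − PK` lands in `𝔪`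
  have hPKz : ∀ Z, PK Z * Nmat = Nmat * PK Z := by
    intro Z
    obtain ⟨z, w, hz, ⟨Y, hY⟩, hzw⟩ := hdec Z
    rw [← hzw, map_add, hPKfix z hz, hY, hPK0 Y, add_zero]
    exact hz
  have hPKm : ∀ Z, ∃ Y : Matrix (Fin m) (Fin m) K, Z - PK Z = Nmat * Y * Ni - Y := by
    intro Z
    obtain ⟨z, w, hz, ⟨Y, hY⟩, hzw⟩ := hdec Z
    refine ⟨Y, ?_⟩
    rw [← hzw, map_add, hPKfix z hz, hY, hPK0 Y, add_zero, add_sub_cancel_left]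
  have hPKidem : ∀ Z, PK (PK Z) = PK Z := fun Z => hPKfix _ (hPKz Z)
  have hPKc : Continuous PK := continuous_linearMap_matrix PK
  -- ### (2) the fixed field `F = K^σ`; `M_m(K)` is finite over it
  obtain ⟨F, hF⟩ := exists_fixedSubfield σ
  haveI : FiniteDimensional ↥F K := finiteDimensional_of_involutive σ h2 hσ2 F hF
  haveI : FiniteDimensional ↥F (Matrix (Fin m) (Fin m) K) := Module.Finite.trans K (Matrix (Fin m) (Fin m) K)
  -- ### (3) the twisted linear part as an `F`-linear map
  let Lf : Matrix (Fin m) (Fin m) K →ₗ[↥F] Matrix (Fin m) (Fin m) K :=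
    { toFun := fun X => Bi * (X - PK X) * B + J⁻¹ * ((X - PK X).map σ)ᵀ * J + PK X
      map_add' := fun X Y => by
        simp only [map_add]
        rw [show X + Y - (PK X + PK Y) = (X - PK X) + (Y - PK Y) by abel, tau_add, Matrix.mul_add, Matrix.add_mul]
        abel
      map_smul' := fun c X => by
        have hc : σ (c : K) = c := (hF c).1 c.2
        simp only [RingHom.id_apply, Subfield.smul_def, map_smul]
        rw [← smul_sub, tau_smul, hc, Matrix.mul_smul, Matrix.smul_mul, smul_add, smul_add] }
  have hLf : ∀ X, Lf X = Bi * (X - PK X) * B + J⁻¹ * ((X - PK X).map σ)ᵀ * J + PK X := fun X => rfl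
  -- ### (4) injectivity (★ (TJ1))
  have hinj : Function.Injective Lf := by
    refine (injective_iff_map_eq_zero Lf).2 fun X hX => ?_
    rw [hLf] at hX
    obtain ⟨Y, hY⟩ := hPKm X
    set w : Matrix (Fin m) (Fin m) K := X - PK X with hwdef
    -- `b⁻¹ w b + τ w ∈ 𝔪`
    have hconj : Bi * w * B = Nmat * (Bi * Y * B) * Nmat⁻¹ - Bi * Y * B := by
      rw [hY, hNiNi]; exact conj_adSubOne b hNu hbN Y
    have hτw : J⁻¹ * (w.map σ)ᵀ * J = Nmat * (J⁻¹ * (Y.map σ)ᵀ * J) * Nmat⁻¹ - J⁻¹ * (Y.map σ)ᵀ * J := by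
      rw [hY, hNiNi]; exact tau_adSubOne hJ hτN' hτNinv'
    have hsum𝔪 : Bi * w * B + J⁻¹ * (w.map σ)ᵀ * J ∈ LinearMap.range (LinearMap.mulLeftRight K ((Nm : Matrix (Fin m) (Fin m) K),
        ((Nm⁻¹ : GL (Fin m) K) : Matrix (Fin m) (Fin m) K)) - LinearMap.id : Matrix (Fin m) (Fin m) K →ₗ[K] Matrix (Fin m) (Fin m) K) := by
      refine (mem_range_adSubOne_iff Nm _).2 ⟨Bi * Y * B + J⁻¹ * (Y.map σ)ᵀ * J, ?_⟩
      rw [hconj, hτw, ← hNiNi]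
      simp only [Matrix.mul_add, Matrix.add_mul]
      abel
    have hz𝔷 : PK X ∈ LinearMap.ker (LinearMap.mulLeftRight K ((Nm : Matrix (Fin m) (Fin m) K),
        ((Nm⁻¹ : GL (Fin m) K) : Matrix (Fin m) (Fin m) K)) - LinearMap.id : Matrix (Fin m) (Fin m) K →ₗ[K] Matrix (Fin m) (Fin m) K) :=
      (mem_ker_adSubOne_iff Nm _).2 (hPKz X)
    -- directness: both summands vanish
    have hneg : PK X = -(Bi * w * B + J⁻¹ * (w.map σ)ᵀ * J) := by
      rw [eq_neg_iff_add_eq_zero, add_comm]; exact hX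
    have hz0 : PK X = 0 := by
      have hmem : PK X ∈ LinearMap.ker (LinearMap.mulLeftRight K ((Nm : Matrix (Fin m) (Fin m) K),
          ((Nm⁻¹ : GL (Fin m) K) : Matrix (Fin m) (Fin m) K)) - LinearMap.id : Matrix (Fin m) (Fin m) K →ₗ[K] Matrix (Fin m) (Fin m) K) ⊓
        LinearMap.range (LinearMap.mulLeftRight K ((Nm : Matrix (Fin m) (Fin m) K),
          ((Nm⁻¹ : GL (Fin m) K) : Matrix (Fin m) (Fin m) K)) - LinearMap.id : Matrix (Fin m) (Fin m) K →ₗ[K] Matrix (Fin m) (Fin m) K) := by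
        refine ⟨hz𝔷, ?_⟩
        rw [hneg]
        exact Submodule.neg_mem _ hsum𝔪
      rw [hcK.inf_eq_bot, Submodule.mem_bot] at hmem
      exact hmem
    have hw0' : Bi * w * B + J⁻¹ * (w.map σ)ᵀ * J = 0 := by
      rw [hz0, add_zero] at hX; exact hX
    -- `τ (S w + w) = b⁻¹ w b + τ w = 0`, hence `S w + w = 0`
    have hSw : J⁻¹ * ((Bi * w * B).map σ)ᵀ * J + w = 0 := by
      have h1 : J⁻¹ * ((J⁻¹ * ((Bi * w * B).map σ)ᵀ * J + w).map σ)ᵀ * J = 0 := by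
        rw [L_eq_tau_comp σ J hJ hJh hσ2 b w]; exact hw0'
      have h2' := congrArg (fun Z => J⁻¹ * (Z.map σ)ᵀ * J) h1
      rw [tau_tau σ J hJ hJh hσ2, hτ0] at h2'
      exact h2'
    -- `(Ad N⁻¹ − 1) w = S (S w + w) − (S w + w) = 0`
    have hRw : (LinearMap.mulLeftRight K (((Nm⁻¹ : GL (Fin m) K) : Matrix (Fin m) (Fin m) K), (Nm : Matrix (Fin m) (Fin m) K)) - LinearMap.id :
        Matrix (Fin m) (Fin m) K →ₗ[K] Matrix (Fin m) (Fin m) K) w = 0 := by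
      have key := S_sub_one_comp_S_add_one σ J hJ hJh hσ2 b w
      rw [hSw, Matrix.mul_zero, Matrix.zero_mul, hτ0, sub_zero, ← hBdef, ← hBidef] at key
      rw [LinearMap.sub_apply, LinearMap.mulLeftRight_apply, LinearMap.id_apply, ← hNidef, hNinv, ← hNmatdef, hN]
      exact key.symm
    have hw𝔪 : w ∈ LinearMap.range (LinearMap.mulLeftRight K ((Nm : Matrix (Fin m) (Fin m) K),
        ((Nm⁻¹ : GL (Fin m) K) : Matrix (Fin m) (Fin m) K)) - LinearMap.id : Matrix (Fin m) (Fin m) K →ₗ[K] Matrix (Fin m) (Fin m) K) :=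
      (mem_range_adSubOne_iff Nm _).2 ⟨Y, hY⟩
    have hw0 : w = 0 := eq_zero_of_adInvSubOne_eq_zero Nm hsep hw𝔪 hRw
    -- `X = w + PK X = 0`
    have : X = w + PK X := by rw [hwdef, sub_add_cancel]
    rw [this, hw0, hz0, add_zero]
  -- ### (5) bijectivity, continuity, and the open mapping theorem
  have hsurj : Function.Surjective Lf := LinearMap.injective_iff_surjective.1 hinj
  let Le : Matrix (Fin m) (Fin m) K ≃ₗ[↥F] Matrix (Fin m) (Fin m) K := LinearEquiv.ofBijective Lf ⟨hinj, hsurj⟩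
  have hLe : ∀ X, Le X = Lf X := fun X => rfl
  have hτc : Continuous fun X : Matrix (Fin m) (Fin m) K => J⁻¹ * (X.map σ)ᵀ * J :=
    (continuous_const.mul (continuous_id.matrix_map hσc).matrix_transpose).mul continuous_const
  have hLc : Continuous Le := by
    show Continuous fun X => Lf X
    simp only [hLf]
    exact (((continuous_const.mul (continuous_id.sub hPKc)).mul continuous_const).add
      (hτc.comp (continuous_id.sub hPKc))).add hPKc
  haveI : LocallyCompactSpace (Matrix (Fin m) (Fin m) K) := inferInstanceAs (LocallyCompactSpace (Fin m → Fin m → K))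
  haveI : SecondCountableTopology (Matrix (Fin m) (Fin m) K) := inferInstanceAs (SecondCountableTopology (Fin m → Fin m → K))
  have hLopen : IsOpenMap Le := AddMonoidHom.isOpenMap_of_sigmaCompact Le.toLinearMap.toAddMonoidHom Le.surjective hLc
  let Lh : Matrix (Fin m) (Fin m) K ≃ₜ Matrix (Fin m) (Fin m) K := Le.toEquiv.toHomeomorphOfContinuousOpen hLc hLopen
  let L : Matrix (Fin m) (Fin m) K ≃ₜ+ Matrix (Fin m) (Fin m) K := { Le.toAddEquiv with continuous_toFun := hLc, continuous_invFun := Lh.symm.continuous }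
  have hLapp : ∀ X, L X = Lf X := fun X => rfl
  have hLsymm : ∀ X, L.symm X = Le.symm X := fun X => rfl
  -- ### (6) the letters
  refine ⟨(LinearMap.id - PK : Matrix (Fin m) (Fin m) K →ₗ[K] Matrix (Fin m) (Fin m) K).toAddMonoidHom, PK.toAddMonoidHom, L,
    fun Z => ?_, fun Z => ?_, ?_, hPKc, fun Z => hPKz Z, fun X hX => ?_, fun Z => ?_, fun Z => ?_, fun X hX => ?_, fun X Y hXY => ?_,
    fun c Z => ?_, fun c Z => map_smul PK c Z, fun c hc Z => ?_, fun c hc Z => ?_⟩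
  · show Z - PK Z + PK Z = Z
    exact sub_add_cancel Z (PK Z)
  · show Z - PK Z - PK (Z - PK Z) = Z - PK Z
    rw [map_sub, hPKidem, sub_self, sub_zero]
  · show Continuous fun Z : Matrix (Fin m) (Fin m) K => Z - PK Z
    exact continuous_id.sub hPKc
  · show X - PK X = 0
    rw [hPKfix X hX, sub_self]
  · show ∃ Y : Matrix (Fin m) (Fin m) K, Z - PK Z = Nmat * Y * Ni - Y
    exact hPKm Z
  · show Lf Z = Bi * (Z - PK Z) * B + J⁻¹ * ((Z - PK Z).map σ)ᵀ * J + PK Z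
    rfl
  · show Lf X = X
    rw [hLf, hPKfix X hX, sub_self, Matrix.mul_zero, Matrix.zero_mul, hτ0, zero_add, zero_add]
  · show Lf X = Bi * X * B + J⁻¹ * (X.map σ)ᵀ * J
    have hPX : PK X = 0 := by rw [hXY]; exact hPK0 Y
    rw [hLf, hPX, sub_zero, add_zero]
  · show c • Z - PK (c • Z) = c • (Z - PK Z)
    rw [map_smul, smul_sub]
  · show Lf (c • Z) = c • Lf Z
    have h := Lf.map_smul (⟨c, (hF c).2 hc⟩ : ↥F) Z
    rwa [Subfield.smul_def, Subfield.smul_def] at h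
  · rw [hLsymm, hLsymm]
    have h := Le.symm.map_smul (⟨c, (hF c).2 hc⟩ : ↥F) Z
    rwa [Subfield.smul_def, Subfield.smul_def] at h

end Summit.HodgeConjecture.HodgeConjecture.R90.S4
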